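import Summits.ValiantsHypothesis.ValiantsHypothesis.Theses.ShallowShadows
import Literature.Barriers.ValiantsHypothesis.CharacteristicTwoProofs
import Literature.Computability.AlgebraicComplexity.PermanentIrreducible
import Literature.Computability.AlgebraicComplexity.StandardFamiliesProofs
import Literature.Computability.AlgebraicComplexity.DeterminantalComplexity
import Literature.Computability.Complexity.KWProtocolFormula

/-!
# Disproof of `ShadowFormulaTransfer` — findings (cdisprove `stmt-ValiantsHypothesis-17124`, cycle 1)

Crux (route `ShallowShadows`, decl `ShadowFormulaTransfer`, "X"):
`∃ δ > 0, ∃ C, ∀ 0/1-coefficient VP_ℂ families f, eventually in n,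
  L_mon-formula(B f_n) ≤ 2 ^ (deg(f_n)^{1-δ} · (ln(n+2))^C + C)`,
where `B f (a) = [∃ monomial of f with support ⊆ a]` is the shadow.

**Verdict of this cycle: NO KILL.** X is open-problem grade; every cheap attack fails for a
structural reason recorded below. What this file PROVES (sorry-free, standard axioms):

* §1 `ShadowFormulaTransferOver k` — X with the coefficient field as a parameter
  (`shadowFormulaTransferOver_complex_iff : … ℂ ↔ X` by `Iff.rfl`), and the load-bearing lemma
  `shadowFormulaTransferOver_false_of_charP_two :
     RazWigdersonMatching → ∀ k, Field k → CharP k 2 → ¬ ShadowFormulaTransferOver k`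
  (witness `per_n = det_n ∈ VP_k`, tree `isVPFamily_perPoly_of_charTwo_of_commRing`; its
  coefficients are 0/1 over ANY semiring, `coeff_perPoly_eq_zero_or_one`; its shadow is `PM_n`,
  `shadow_perPoly_eq`; contradiction with Raz–Wigderson through `no_window_bound_of_razWigderson`).
  MORAL: the 0/1 hypothesis has teeth only because `-1 ∉ {0,1}` in `ℂ`; any proof of X must use
  a property of `ℂ` that fails in characteristic 2 (an ordering / `1 + 1 ≠ 0`), i.e. it must be a
  POSITIVITY argument, not a support/rank argument (cf. barrier `PermanentCharTwo`, now formal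
  for this crux). Proposed as `Theorems/ShadowFormulaTransfer/Negative/FalseOverCharTwo.lean`
  (p162074, dry-run ACCEPT; variants inlined there, no `def : Prop`), together with §2 and §3.
* §2 `ShadowFormulaTransferPointwise` (δ, C allowed to depend on the family) and
  `pointwise_of_shadowFormulaTransfer`; the route's `closes` goes through VERBATIM from the
  pointwise form (it instantiates X at `per` before touching δ, C). By padding/diagonalisation
  the two forms are equivalent (Remark 2.2), so this is bookkeeping, not an attack surface.
* §4 `shadowFormulaTransfer_false_with_vars_calibration`: X with `log(n+2)` replaced by
  `log(#σ n + 2)` (intrinsic calibration by the number of variables) is FALSE modulo RW92 even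
  for 0/1 VP families — padded permanent `f n = per_m`, `m = (Nat.unpair n).1`, switched on only
  when `complexity per_m ≤ n`. So the `(log(n+2))^C` of X is where CIRCUIT SIZE enters (3.3 made
  formal): no bound in degree + number of variables alone survives. (Second Negative proposal,
  `Negative/VarsCalibration.lean`, p165399, dry-run ACCEPT.)
* Earlier refuter lemmas (p152518, `…/Negative/FalseWithoutZeroOne.lean`, rattack seat; LANDED,
  importable; not re-proved here): modulo `RazWigdersonMatching`, X is false with coefficients in `{0,±1}`
  (witness `det_n`), false with the coefficient hypothesis dropped, and false with `IsVPFamily`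
  dropped (witness `per_n`). Together with §1: **all three hypotheses (VP, 0/1, char 0) are
  load-bearing, and det/per/per-mod-2 all have the SAME shadow `PM_n`** — a proof must use
  cheapness × sign-coherence × positivity jointly.

## 3. Why the cheap attacks fail (numbers, not adjectives)

3.1 *Junk / typing.* `formulaSizeOver monotoneBasis` is an `sInf` over `ℕ` with junk value 0
(constant shadows: `f n = 0`, nonzero constant term); junk only LOWERS the left side. The right
side is `Real.rpow 2 (…) ≥ 2^C ≥ 1`. `IsVPFamily` bounds #vars, degree and `complexity` by
`n^c + c` (Bürgisser Def. 2.1–2.4; constants of ℂ free). Nothing to exploit (agrees with the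
rreview/rattack read-backs).

3.2 *DNF regime.* For any f_n of degree d on N ≤ n^c + c variables the monotone DNF of B f_n has
≤ #supp(f_n) · d ≤ d · N^d gates, so `log₂ L ≤ d·log₂ N + log₂ d ≤ c'·d·log n`. Hence X holds
automatically whenever `d^δ ≤ (ln n)^{C-1}/c'`: a counterexample needs SUPER-POLYLOG degree and
`log L ≥ d^{1-δ}·polylog`, i.e. a shadow of near-maximal depth in the degree scale. In particular
NO finite / small-model computation can refute X (C absorbs every fixed instance): no `kit` job.

3.3 *Padding normal form* (what X really says). Place a single 0/1 polynomial g (N variables,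
degree D, circuit size s) at index n := max(s, N, D) of an otherwise-zero family: that family is
in VP with c = 2. So X ⟺ a NON-asymptotic inequality for all 0/1 polynomials g over ℂ:
`log₂ L(B g) ≤ D^{1-δ} · (ln(s + N + D + 2))^C + C` (same δ, C). Consequently
**¬X ⟺ there are 0/1 polynomials g with log(size·nvars) ≤ deg(g)^{o(1)} but
log L(B g) ≥ deg(g)^{1-o(1)}** — circuit size SUBEXPONENTIAL in every power of the degree is
allowed to the refuter, polynomial size is not required. (This is exactly the shape of the line
det-kw's `stub_detProtocol`, with s = determinantal size.) Even in this relaxed form every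
known mechanism fails:
  - per_m by Ryser/Glynn: log s = Θ(m) = Θ(D) (not D^{o(1)}); a 2^{m^{o(1)}}-size circuit for ANY
    0/1 g with B g = PM_m is unknown (for g = per it contradicts #ETH-type beliefs).
  - affine-subspace enumerators P_A = Σ_{S ∈ A} x^S, A ⊆ 𝔽₂^N of codimension r (XOR-UNSAT,
    odd factor, T-joins; Fourier formula of size 2^r·N): minterms are circuits of a rank-(r+1)
    binary matroid, so D_min ≤ r + 1 ≤ log₂ s — squarely inside the DNF regime 3.2.
  - k-clique enumerators: log s = k log n = Θ(√D · log n) and log L = Θ(k log n) too.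
  - genus-g Pfaffian sums (Galluccio–Loebl/Tesler, 4^g Pfaffians): log s = 2g, separator
    O(√(g·V)) ⇒ log L ≤ Õ(D^{1/2} g^{1/2}); against D^{1-δ}(log s)^C = D^{1-δ}(2g)^C this never
    wins for δ < 1/2. The 4^g is essentially tight and the Pfaffian-sum route to dense hosts is
    exponentially blocked: pf(K_{n,n}) ≥ (8/3)^{⌊n/3⌋}, pf_max(g) ≥ (8/3)^g, and per = Σ cᵢ det(Aᵢ)
    with sign-changed Aᵢ needs k ≥ (8/3)^{⌊n/3⌋} terms (arXiv:2605.21077, Thms 1.1–1.3, read).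

3.4 *Census of cancellation-born 0/1 VP families* (exponent α in log L ≈ D^α; X claims α ≤ 1-δ):
planar / bipartite-Pfaffian (= trisums of planar braces + Heawood, RST–McCuaig) / K₅-, K₃,₃-free /
genus O(log n) perfect matchings: α = 1/2 (planar separators); det-based spanning trees,
arborescences, rooted forests: log L = O(log² n); DAG path polynomials / IMM: O(log d · log n);
regular-matroid bases (Seymour decomposition): O(log² N); LGV non-intersecting paths: 0/1 forces
all realised pairings to have one sign, for k = 2 this is 2-linkage infeasibility, whose structure
theorem (Seymour, Thomassen; acyclic case Thomassen 1985) is planar-with-terminals-on-a-face up to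
≤3-separations ⇒ separators ⇒ α ≤ 1/2; e_d, h_d, threshold: poly; group subset-sum via Fourier,
bounded-treewidth hom/CSP polynomials: O(log d log n). Max known α = 1/2. (Agrees with and extends
the rattack census; new here: the LGV/2-linkage reason, the genus computation, 3.3.)

3.5 *Deep monotone functions whose enumerators are NOT in VP* (the far side has no cheap witness):
PM_m on K_{m,m} (RW92, 2^{Ω(m)}; enumerator per ∉ VP conjecturally), odd factor on K_n (BGW99,
2^{Ω(n)} formulas, arXiv:2507.16105 §1.2 — but D = Θ(n²) for the full enumerator, α = 1/2, and the
T-join enumerator of K_n is an Ising partition function, VNP-hard), XOR-SAT (GKRS19/GGKS20,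
⊕L-complete, exponential monotone circuits; enumerator = P_A of 3.3, D ≤ log s), lifted
Tseitin/pebbling CSP-SAT functions (GP14, GGKS18, Pitassi–Robere): enumerator Σ_β Π_C x_{C,β|C}
is a #CSP tensor network on an expanding constraint graph — VNP-hard for unbounded treewidth,
and bounded treewidth makes the shadow shallow. Pattern: "natural enumerator in VP" ⟸ planar /
Pfaffian / TU / triangular / bounded-tw structure ⟹ separators or rank ⟹ α ≤ 1/2.

3.6 *Remaining threats* (none cheap; for ideators): (T1) NON-bipartite Pfaffian graph families
without sublinear separators (structure of non-bipartite Pfaffian graphs is open; but a robustly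
matchable expander contains a CENTRAL even subdivision of K₃,₃ — route 9 odd paths using odd
cycles, the complement keeps a perfect matching by robust Tutte — so is NOT Pfaffian: Pfaffian
hosts look structurally degenerate), AND a host-restricted Raz–Wigderson bound (RW92 is for
K_{m,m}; a monotone projection from PM_m uses m² host edges, capping the inherited bound at
α = 1/2 on sparse hosts — a direct lifting-style bound on an expander host would be new
monotone complexity); (T2) unknown sign-coherent TU pairs det(A·X·Bᵀ) with matching-hard
common-basis up-sets; (T3) a 2^{m^{o(1)}}-size circuit for some 0/1 g with B g = PM_m and
deg g ≤ m^{1+o(1)} (3.3) — would also be a breakthrough in exponential-time counting.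

3.7 *Calibration tightness not formalisable here*: "δ cannot exceed 1/2" would follow from a
2^{Ω̃(√V)} monotone-formula LOWER bound for planar-grid perfect matching, which is not in print
(only the separator UPPER bound is); "C ≥ 2 needed" would follow from KW90 (st-connectivity
n^{Ω(log n)}, spanning-tree enumerator ∈ VP by matrix-tree) — not in the tree. No Lean lower bound
on `formulaSizeOver` beyond `RazWigdersonMatching` (an open item) and Razborov85 (quasi-poly,
too weak against (ln n)^C) is available, so every negative lemma here is modulo RW92.

-- Targets (payload.stuck_stubs = [] this cycle; line det-kw, lead reshape: open stub
`stub_detProtocolWindow` = X relocated onto one affine symbolic matrix in KW-depth form, 3.3):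
§3 `detProtocolWindow_false_over_charP_two` — the window stub stated over any field of
characteristic 2 is FALSE modulo RW92 (witness `per_M = det_M`: `HasDetRepr _ M`, 0/1, `M²`
variables, degree `M`, in the window for large `M`; its shadow `PM_M` has no protocol of depth
`< c·M` by RW92 + the landed `KWTree.formulaSizeOver_le_two_pow_depth`). So the stub's proof must
use that over `ℂ` "small det-representation" and "0/1 support" are JOINTLY rare (the 0/1 pattern
`PM_M` is `per` over `ℂ` but `det` over `𝔽₂`): a positivity argument, again. The stub over `ℂ`
itself is X-hard (no separate cheap attack); `stub_kwFormula` and `ShadowTrivialProtocol` are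
theorems (landed).
-/

namespace Summit.ValiantsHypothesis.ValiantsHypothesis.Cruxes.ShadowFormulaTransfer.Disproof

set_option linter.dupNamespace false

open Literature.Computability.AlgebraicComplexity Literature.Computability.Complexity
open Literature.Barriers.PneNP MvPolynomial Filter
open Summit.ValiantsHypothesis.ValiantsHypothesis.Theses.ShallowShadows

/-! ## §0 The shadow of the permanent over an arbitrary nontrivial semiring -/

section PerShadow

variable (k : Type*) [CommSemiring k]

/-- Over ANY commutative semiring every coefficient of `per_m` is `0` or `1` (distinct
permutations have distinct monomials). [folklore] -/
theorem coeff_perPoly_eq_zero_or_one {m : ℕ} (d : Fin m × Fin m →₀ ℕ) :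
    (perPoly (Fin m) k).coeff d = 0 ∨ (perPoly (Fin m) k).coeff d = 1 := by
  by_cases h : ∃ ρ : Equiv.Perm (Fin m), permMonomial ρ = d
  · obtain ⟨ρ, rfl⟩ := h
    exact Or.inr (coeff_permMonomial_perPoly k ρ)
  · left
    by_contra hne
    exact h (exists_permMonomial_eq_of_coeff_perPoly_ne_zero k hne)

variable [Nontrivial k]

/-- Support of `per_m` over a nontrivial semiring = permutation monomials. [folklore] -/
theorem mem_support_perPoly_iff {m : ℕ} (mo : Fin m × Fin m →₀ ℕ) :
    mo ∈ (perPoly (Fin m) k).support ↔ ∃ ρ : Equiv.Perm (Fin m), permMonomial ρ = mo := by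
  rw [MvPolynomial.mem_support_iff]
  constructor
  · exact exists_permMonomial_eq_of_coeff_perPoly_ne_zero k
  · rintro ⟨ρ, rfl⟩
    rw [coeff_permMonomial_perPoly]
    exact one_ne_zero

omit [Nontrivial k] in
/-- The cells of a permutation monomial. [folklore] -/
theorem mem_support_permMonomial_iff {m : ℕ} (ρ : Equiv.Perm (Fin m)) (p : Fin m × Fin m) :
    p ∈ (permMonomial ρ).support ↔ ρ p.2 = p.1 := by
  obtain ⟨r, c⟩ := p
  rw [Finsupp.mem_support_iff, permMonomial_apply]
  by_cases h : ρ c = r <;> simp [h]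

/-- The shadow of `per_m` is the bipartite perfect matching predicate. [folklore] -/
theorem shadow_perPoly_iff {m : ℕ} (a : Fin m × Fin m → Bool) :
    (∃ mo ∈ (perPoly (Fin m) k).support, ∀ i ∈ mo.support, a i = true) ↔
      ∃ σ : Equiv.Perm (Fin m), ∀ i, a (i, σ i) = true := by
  constructor
  · rintro ⟨mo, hmo, ha⟩
    obtain ⟨ρ, rfl⟩ := (mem_support_perPoly_iff k mo).1 hmo
    refine ⟨ρ.symm, fun i => ha _ ?_⟩
    rw [mem_support_permMonomial_iff]
    simp
  · rintro ⟨σ, hσ⟩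
    refine ⟨permMonomial σ.symm, (mem_support_perPoly_iff k _).2 ⟨σ.symm, rfl⟩, ?_⟩
    rintro ⟨r, c⟩ hp
    rw [mem_support_permMonomial_iff] at hp
    simp only at hp
    subst hp
    simpa using hσ (σ.symm c)

/-- `B(per_m) = PM_m` as Boolean functions, over any nontrivial semiring. [folklore] -/
theorem shadow_perPoly_eq (m : ℕ) :
    (fun a : Fin m × Fin m → Bool =>
      decide (∃ mo ∈ (perPoly (Fin m) k).support, ∀ i ∈ mo.support, a i = true)) =
      perfectMatchingFn m := by
  funext a
  unfold perfectMatchingFn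
  exact decide_eq_decide.mpr (shadow_perPoly_iff k a)

/-- `deg per_m = m` over a nontrivial semiring (tree fact `totalDegree_perPoly`). [folklore] -/
theorem totalDegree_perPoly_fin (m : ℕ) : (perPoly (Fin m) k).totalDegree = m := by
  rw [(totalDegree_perPoly_holds (n := Fin m) (k := k) : (perPoly (Fin m) k).totalDegree = _),
    Fintype.card_fin]

end PerShadow

/-! ## §0' The analytic window and the Raz–Wigderson contradiction, isolated -/

/-- `x^{1-δ} (log (x+2))^C + C < c·x` eventually (the window of `closes`, restated). [folklore] -/
theorem eventually_window (δ : ℝ) (hδ : 0 < δ) (C : ℕ) (c : ℝ) (hc : 0 < c) :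
    ∀ᶠ x : ℝ in atTop, x ^ (1 - δ) * Real.log (x + 2) ^ C + C < c * x := by
  have hlo := isLittleO_log_rpow_rpow_atTop (C : ℝ) hδ
  have hε : 0 < c / 2 ^ (C + 2) := by positivity
  filter_upwards [hlo.def hε, eventually_ge_atTop (2 : ℝ), eventually_gt_atTop (4 * C / c + 1)]
    with x hx hx2 hxC
  have hx0 : 0 < x := by linarith
  have hlog2 : Real.log (x + 2) ≤ 2 * Real.log x := by
    have hsq : x + 2 ≤ x ^ 2 := by nlinarith
    calc Real.log (x + 2) ≤ Real.log (x ^ 2) := Real.log_le_log (by linarith) hsq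
      _ = 2 * Real.log x := by rw [Real.log_pow]; norm_num
  have hlog0 : 0 ≤ Real.log (x + 2) := Real.log_nonneg (by linarith)
  have hlogx0 : 0 ≤ Real.log x := Real.log_nonneg (by linarith)
  have hpowC : Real.log (x + 2) ^ C ≤ 2 ^ C * Real.log x ^ C := by
    calc Real.log (x + 2) ^ C ≤ (2 * Real.log x) ^ C := pow_le_pow_left₀ hlog0 hlog2 C
      _ = 2 ^ C * Real.log x ^ C := by rw [mul_pow]
  have hxδ0 : 0 < x ^ δ := Real.rpow_pos_of_pos hx0 δ
  have hlo' : Real.log x ^ C ≤ c / 2 ^ (C + 2) * x ^ δ := by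
    have := hx
    rw [Real.norm_of_nonneg (by positivity), Real.norm_of_nonneg hxδ0.le] at this
    rwa [Real.rpow_natCast] at this
  have hx1δ0 : 0 < x ^ (1 - δ) := Real.rpow_pos_of_pos hx0 _
  have hsplit : x ^ (1 - δ) * x ^ δ = x := by
    rw [← Real.rpow_add hx0]; norm_num
  have hconst : (2 : ℝ) ^ C * (c / 2 ^ (C + 2)) = c / 4 := by
    rw [pow_add]; field_simp; ring
  have hmain : x ^ (1 - δ) * Real.log (x + 2) ^ C ≤ c / 4 * x := by
    calc x ^ (1 - δ) * Real.log (x + 2) ^ C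
        ≤ x ^ (1 - δ) * (2 ^ C * (c / 2 ^ (C + 2) * x ^ δ)) := by
          apply mul_le_mul_of_nonneg_left _ hx1δ0.le
          exact hpowC.trans (mul_le_mul_of_nonneg_left hlo' (by positivity))
      _ = (2 ^ C * (c / 2 ^ (C + 2))) * (x ^ (1 - δ) * x ^ δ) := by ring
      _ = c / 4 * x := by rw [hconst, hsplit]
  have hCx : (C : ℝ) < c / 4 * x := by
    have : 4 * (C : ℝ) / c < x - 1 := by linarith
    have h4 : 4 * (C : ℝ) < (x - 1) * c := by
      rwa [div_lt_iff₀ hc] at this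
    nlinarith
  nlinarith

/-- Given Raz–Wigderson, `PM_n` admits NO eventual bound of the window shape
`2^{n^{1-δ}(log(n+2))^C + C}` — the contradiction step of `closes`, isolated so that every
witness family with shadow `PM_n` and degree `n` can reuse it. [folklore] -/
theorem no_window_bound_of_razWigderson (hRW : RazWigdersonMatching) {δ : ℝ} (hδ : 0 < δ)
    (C n₀ : ℕ) :
    ¬ ∀ n ≥ n₀, (formulaSizeOver monotoneBasis (perfectMatchingFn n) : ℝ) ≤
        2 ^ ((n : ℝ) ^ (1 - δ) * Real.log (n + 2) ^ C + C) := by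
  intro h
  obtain ⟨c, hc, m₀, hm₀⟩ := hRW
  obtain ⟨N, hN⟩ := eventually_atTop.mp
    ((tendsto_natCast_atTop_atTop (R := ℝ)).eventually (eventually_window δ hδ C c hc))
  let n : ℕ := max (max n₀ m₀) N
  have hb := h n ((le_max_left _ _).trans (le_max_left _ _))
  have hr := hm₀ n ((le_max_right _ _).trans (le_max_left _ _))
  have hw := hN n (le_max_right _ _)
  have hchain := hr.trans hb
  rw [Real.rpow_le_rpow_left_iff (by norm_num : (1 : ℝ) < 2)] at hchain
  linarith

/-! ## §1 Load-bearing: the field. X over a field of characteristic two is false (mod RW92). -/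

/-- X with the coefficient field `k` as a parameter (`k = ℂ` is the crux verbatim). -/
def ShadowFormulaTransferOver (k : Type) [Field k] : Prop :=
  ∃ δ : ℝ, 0 < δ ∧ ∃ C : ℕ, ∀ (σ : ℕ → Type) [∀ n, Fintype (σ n)] [∀ n, DecidableEq (σ n)]
    (f : ∀ n, MvPolynomial (σ n) k), IsVPFamily f →
    (∀ (n : ℕ) (m : σ n →₀ ℕ), (f n).coeff m = 0 ∨ (f n).coeff m = 1) →
    ∃ n₀ : ℕ, ∀ n ≥ n₀, (formulaSizeOver monotoneBasis
      (fun a : σ n → Bool => decide (∃ m ∈ (f n).support, ∀ i ∈ m.support, a i = true)) : ℝ)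
      ≤ 2 ^ (((f n).totalDegree : ℝ) ^ (1 - δ) * (Real.log (n + 2)) ^ C + C)

/-- Sanity: at `k = ℂ` the parametrised statement IS the crux, definitionally. -/
theorem shadowFormulaTransferOver_complex_iff :
    ShadowFormulaTransferOver ℂ ↔ ShadowFormulaTransfer := Iff.rfl

/-- **Load-bearing (field / positivity).** Over every field of characteristic `2` the transfer X
is FALSE modulo Raz–Wigderson: `per_n = det_n ∈ VP_k` (tree:
`isVPFamily_perPoly_of_charTwo_of_commRing`), its coefficients are `0/1`, its shadow is `PM_n` of
monotone formula size `2^{Ω(n)}`, but `deg per_n = n` makes the window `2^{n^{1-δ} polylog}`.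
So any proof of X must use a property of `ℂ` absent in characteristic 2 (that `-1 ∉ {0,1}`,
i.e. positivity), not merely supports/ranks — the `PermanentCharTwo` barrier, made formal for
this crux. [folklore] -/
theorem shadowFormulaTransferOver_false_of_charP_two (hRW : RazWigdersonMatching)
    (k : Type) [Field k] [CharP k 2] : ¬ ShadowFormulaTransferOver k := by
  rintro ⟨δ, hδ, C, hC⟩
  obtain ⟨n₀, hn₀⟩ := hC (fun n => Fin n × Fin n) (fun n => perPoly (Fin n) k)
    (Literature.Barriers.ValiantsHypothesis.isVPFamily_perPoly_of_charTwo_of_commRing k)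
    (fun n mo => coeff_perPoly_eq_zero_or_one k mo)
  refine no_window_bound_of_razWigderson hRW hδ C n₀ fun n hn => ?_
  have h := hn₀ n hn
  simp only [shadow_perPoly_eq k n, totalDegree_perPoly_fin k n] at h
  exact h

/-- In particular over `𝔽₂ = ZMod 2`, where the 0/1 hypothesis is VACUOUS (every element is 0
or 1): "X for all fields" is false modulo RW92. [folklore] -/
theorem shadowFormulaTransferOver_zmod_two_false (hRW : RazWigdersonMatching) :
    ¬ ShadowFormulaTransferOver (ZMod 2) :=
  shadowFormulaTransferOver_false_of_charP_two hRW (ZMod 2)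

/-- The field-uniform strengthening of X is false (mod RW92). [folklore] -/
theorem not_forall_field_shadowFormulaTransferOver (hRW : RazWigdersonMatching) :
    ¬ ∀ (k : Type) [Field k], ShadowFormulaTransferOver k :=
  fun h => shadowFormulaTransferOver_zmod_two_false hRW (h (ZMod 2))

/-! ## §2 Quantifier strength: the pointwise form suffices for `closes` -/

/-- X with `δ, C` allowed to depend on the family (formally weaker). -/
def ShadowFormulaTransferPointwise : Prop :=
  ∀ (σ : ℕ → Type) [∀ n, Fintype (σ n)] [∀ n, DecidableEq (σ n)]
    (f : ∀ n, MvPolynomial (σ n) ℂ), IsVPFamily f →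
    (∀ (n : ℕ) (m : σ n →₀ ℕ), (f n).coeff m = 0 ∨ (f n).coeff m = 1) →
    ∃ δ : ℝ, 0 < δ ∧ ∃ C n₀ : ℕ, ∀ n ≥ n₀, (formulaSizeOver monotoneBasis
      (fun a : σ n → Bool => decide (∃ m ∈ (f n).support, ∀ i ∈ m.support, a i = true)) : ℝ)
      ≤ 2 ^ (((f n).totalDegree : ℝ) ^ (1 - δ) * (Real.log (n + 2)) ^ C + C)

/-- X ⇒ pointwise X (trivial direction). Remark 2.1: the deciding theorem `closes h1 hRW` uses
`h1` only through this consequence (it instantiates at `f = per` first), so the planner may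
weaken the crux to the pointwise form at zero cost to the route. Remark 2.2 (not formalised):
conversely pointwise X ⇒ X by diagonalisation — if X failed, pick for each j a violating family
for (δ, C) = (1/j, j), pad indices polynomially so that all members satisfy `complexity, #vars,
deg ≤ 2n ≤ n² + 2`, and interleave them into ONE 0/1 VP family, which then violates every
(δ, C); so the two forms are equivalent and uniformity is not an attack surface. [folklore] -/
theorem pointwise_of_shadowFormulaTransfer (h : ShadowFormulaTransfer) :
    ShadowFormulaTransferPointwise := by
  intro σ _ _ f hVP h01
  obtain ⟨δ, hδ, C, hC⟩ := h
  obtain ⟨n₀, hn₀⟩ := hC σ f hVP h01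
  exact ⟨δ, hδ, C, n₀, hn₀⟩

/-- The pointwise form already refutes `per ∈ VP_ℂ` given RW92 (so it carries the whole
deciding power of the crux). [folklore] -/
theorem not_isVPFamily_per_of_pointwise (h : ShadowFormulaTransferPointwise)
    (hRW : RazWigdersonMatching) :
    ¬ IsVPFamily (fun n => perPoly (Fin n) ℂ) := by
  intro hVP
  obtain ⟨δ, hδ, C, n₀, hn₀⟩ := h (fun n => Fin n × Fin n) (fun n => perPoly (Fin n) ℂ) hVP
    (fun n mo => coeff_perPoly_eq_zero_or_one ℂ mo)
  refine no_window_bound_of_razWigderson hRW hδ C n₀ fun n hn => ?_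
  have h := hn₀ n hn
  simp only [shadow_perPoly_eq ℂ n, totalDegree_perPoly_fin ℂ n] at h
  exact h

/-! ## §3 Line det-kw: the window stub over a field of characteristic two is false (mod RW92)

`stub_detProtocolWindow` (lead reshape 2026-08-17 of `stub_detProtocol`, line `Lines/det_kw.lean`)
is X relocated onto ONE affine symbolic matrix, in monotone-KW-depth form and uniform in the
instance. Over a field of characteristic 2 the SAME statement is false modulo Raz–Wigderson:
`g = per_M = det_M` has `HasDetRepr g M`, 0/1 coefficients, `M²` variables, degree `M`, its
instance lies in the window for large `M`, and its shadow `PM_M` has no protocol of depth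
`< c·M` (RW92 + the landed easy KW direction `KWTree.formulaSizeOver_le_two_pow_depth`).
So a proof of the window stub must use, beyond "small det-representation + 0/1 support",
that over `ℂ` these two are JOINTLY rare (positivity: over `ℂ` the 0/1 pattern `PM_M` is `per`,
over `𝔽₂` it is `det`). -/

/-- **Target (line det-kw), characteristic-2 variant of `stub_detProtocolWindow` is false**
modulo `RazWigdersonMatching`; witness `per_M = det_M` over `k`, `M` large. [folklore] -/
theorem detProtocolWindow_false_over_charP_two (hRW : RazWigdersonMatching)
    (k : Type) [Field k] [CharP k 2] :
    ¬ ∃ δ : ℝ, 0 < δ ∧ δ < 1 ∧ ∃ C : ℕ, ∀ (ι : Type) [Fintype ι] [Nonempty ι]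
      (g : MvPolynomial ι k) (m : ℕ), HasDetRepr g m →
      (∀ mo : ι →₀ ℕ, g.coeff mo = 0 ∨ g.coeff mo = 1) →
      (g.totalDegree : ℝ) ^ (1 - δ) * (Real.log ((m : ℝ) + (Fintype.card ι : ℝ) + 2)) ^ C + C <
        ((min (g.totalDegree * Nat.clog 2 (Fintype.card ι + 1) + Nat.clog 2 (Fintype.card ι))
          (Fintype.card ι + Nat.clog 2 (Fintype.card ι)) : ℕ) : ℝ) →
      ∃ P : KWTree ι,
        P.SolvesMono (fun a : ι → Bool => decide (∃ mo ∈ g.support, ∀ i ∈ mo.support, a i = true)) ∧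
        (P.depth : ℝ) ≤ (g.totalDegree : ℝ) ^ (1 - δ) *
          (Real.log ((m : ℝ) + (Fintype.card ι : ℝ) + 2)) ^ C + C := by
  rintro ⟨δ, hδ, -, C, hC⟩
  obtain ⟨c, hc, m₀, hm₀⟩ := hRW
  have hmin : 0 < min c 1 := lt_min hc one_pos
  have hc₁pos : 0 < min c 1 / 2 ^ (C + 1) := by positivity
  obtain ⟨N, hN⟩ := eventually_atTop.mp ((tendsto_natCast_atTop_atTop (R := ℝ)).eventually
    (eventually_window δ hδ C (min c 1 / 2 ^ (C + 1)) hc₁pos))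
  -- the witness size
  obtain ⟨M, hMm₀, hMN, hM1⟩ : ∃ M : ℕ, m₀ ≤ M ∧ N ≤ M ∧ 1 ≤ M :=
    ⟨max (max m₀ N) 1, (le_max_left _ _).trans (le_max_left _ _),
      (le_max_right _ _).trans (le_max_left _ _), le_max_right _ _⟩
  have hMpos : (0 : ℝ) < M := by exact_mod_cast hM1
  have hw := hN M hMN
  -- instantiate the stub at `per_M = det_M` over `k`
  haveI : Nonempty (Fin M × Fin M) := ⟨(⟨0, hM1⟩, ⟨0, hM1⟩)⟩
  have hrepr : HasDetRepr (perPoly (Fin M) k) M := by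
    rw [perPoly_eq_detPoly_of_charP_two]; exact hasDetRepr_detPoly M
  have hdeg : (perPoly (Fin M) k).totalDegree = M := totalDegree_perPoly_fin k M
  have hcard : Fintype.card (Fin M × Fin M) = M * M := by simp
  have hspec := hC (Fin M × Fin M) (perPoly (Fin M) k) M hrepr
    (fun mo => coeff_perPoly_eq_zero_or_one k mo)
  rw [hdeg, hcard] at hspec
  -- the budget `B` at this instance is `< (min c 1 / 2) · M`
  set B : ℝ := (M : ℝ) ^ (1 - δ) * Real.log ((M : ℝ) + ((M * M : ℕ) : ℝ) + 2) ^ C + C with hBdef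
  have hlog0 : 0 ≤ Real.log ((M : ℝ) + ((M * M : ℕ) : ℝ) + 2) :=
    Real.log_nonneg (by push_cast; nlinarith)
  have hlog : Real.log ((M : ℝ) + ((M * M : ℕ) : ℝ) + 2) ≤ 2 * Real.log ((M : ℝ) + 2) := by
    calc Real.log ((M : ℝ) + ((M * M : ℕ) : ℝ) + 2)
        ≤ Real.log (((M : ℝ) + 2) ^ 2) := by
          apply Real.log_le_log (by push_cast; nlinarith)
          push_cast; nlinarith
      _ = 2 * Real.log ((M : ℝ) + 2) := by rw [Real.log_pow]; norm_num
  have hpowC : Real.log ((M : ℝ) + ((M * M : ℕ) : ℝ) + 2) ^ C ≤ 2 ^ C * Real.log ((M : ℝ) + 2) ^ C := by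
    calc _ ≤ (2 * Real.log ((M : ℝ) + 2)) ^ C := pow_le_pow_left₀ hlog0 hlog C
      _ = 2 ^ C * Real.log ((M : ℝ) + 2) ^ C := by rw [mul_pow]
  have hrpow0 : 0 ≤ (M : ℝ) ^ (1 - δ) := (Real.rpow_pos_of_pos hMpos _).le
  have hlogM0 : 0 ≤ Real.log ((M : ℝ) + 2) ^ C := pow_nonneg (Real.log_nonneg (by linarith)) C
  have h2C : (1 : ℝ) ≤ 2 ^ C := one_le_pow₀ (by norm_num)
  have hB : B < min c 1 / 2 * M := by
    have h1 : (M : ℝ) ^ (1 - δ) * Real.log ((M : ℝ) + ((M * M : ℕ) : ℝ) + 2) ^ C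
        ≤ 2 ^ C * ((M : ℝ) ^ (1 - δ) * Real.log ((M : ℝ) + 2) ^ C) := by
      calc _ ≤ (M : ℝ) ^ (1 - δ) * (2 ^ C * Real.log ((M : ℝ) + 2) ^ C) :=
            mul_le_mul_of_nonneg_left hpowC hrpow0
        _ = _ := by ring
    have h2 : B ≤ 2 ^ C * ((M : ℝ) ^ (1 - δ) * Real.log ((M : ℝ) + 2) ^ C + C) := by
      have hC0 : (0 : ℝ) ≤ C := Nat.cast_nonneg C
      rw [hBdef]; nlinarith
    have h3 : (2 : ℝ) ^ C * (min c 1 / 2 ^ (C + 1) * M) = min c 1 / 2 * M := by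
      rw [pow_succ]; field_simp
    calc B ≤ _ := h2
      _ < 2 ^ C * (min c 1 / 2 ^ (C + 1) * M) := by
          apply mul_lt_mul_of_pos_left hw (by positivity)
      _ = min c 1 / 2 * M := h3
  have hBM : B < M := by
    have : min c 1 / 2 * (M : ℝ) ≤ 1 / 2 * M :=
      mul_le_mul_of_nonneg_right (by linarith [min_le_right c 1]) hMpos.le
    linarith
  have hBc : B < c * M := by
    have : min c 1 / 2 * (M : ℝ) ≤ c / 2 * M :=
      mul_le_mul_of_nonneg_right (by linarith [min_le_left c 1]) hMpos.le
    nlinarith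
  -- the instance lies in the window
  have hclog : 1 ≤ Nat.clog 2 (M * M + 1) := Nat.clog_pos one_lt_two (by nlinarith)
  have hwin : B < ((min (M * Nat.clog 2 (M * M + 1) + Nat.clog 2 (M * M))
      (M * M + Nat.clog 2 (M * M)) : ℕ) : ℝ) := by
    refine hBM.trans_le ?_
    exact_mod_cast le_min (by nlinarith) (by nlinarith [Nat.zero_le (Nat.clog 2 (M * M))])
  obtain ⟨P, hP, hPd⟩ := hspec hwin
  -- `P` solves the monotone KW game of `PM_M` in depth `≤ B < c·M`: contradiction with RW92
  have hP' : P.SolvesMono (perfectMatchingFn M) := by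
    intro a b ha hb
    have ha' := (shadow_perPoly_iff k a).2 ((perfectMatchingFn_eq_true_iff M a).1 ha)
    have hb' : ¬ ∃ mo ∈ (perPoly (Fin M) k).support, ∀ i ∈ mo.support, b i = true := by
      intro h
      have := (perfectMatchingFn_eq_true_iff M b).2 ((shadow_perPoly_iff k b).1 h)
      rw [this] at hb
      exact Bool.noConfusion hb
    -- the stub's `decide` carries the `Fintype`-based instance; bridge through the propositions
    refine hP a b ?_ ?_
    · simp only [decide_eq_true_eq]; exact ha'
    · simp only [decide_eq_false_iff_not]; exact hb'
  have hKW := KWTree.formulaSizeOver_le_two_pow_depth P hP'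
  have hr := hm₀ M hMm₀
  have h2 : ((formulaSizeOver monotoneBasis (perfectMatchingFn M) : ℕ) : ℝ) ≤
      (2 : ℝ) ^ ((P.depth : ℕ) : ℝ) := by
    rw [Real.rpow_natCast]; exact_mod_cast hKW
  have h3 := hr.trans h2
  rw [Real.rpow_le_rpow_left_iff (by norm_num : (1 : ℝ) < 2)] at h3
  linarith

/-! ## §4 Load-bearing: the index inside the logarithm (= circuit size), not the number of variables

X calibrates the polylog factor by the INDEX `n`; through `IsVPFamily` (`complexity f_n ≤ n^c + c`)
this is `polylog(circuit size)`. The "intrinsic" variant calibrated by the number of variables of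
`f_n` itself is false modulo RW92, by PADDING the permanent inside VP: circuit size must enter. -/

/-- `complexity 0 = 0` (constants are free). [folklore] -/
theorem complexity_zero_eq {τ : Type*} : complexity (0 : MvPolynomial τ ℂ) = 0 := by
  have h : complexity (MvPolynomial.C (0 : ℂ) : MvPolynomial τ ℂ) = 0 := complexity_C_holds (0 : ℂ)
  simpa using h

/-- **Load-bearing (index / circuit size).** X with `log (n + 2)` replaced by `log (#σ n + 2)` is
FALSE modulo RW92, even for 0/1 VP families. Witness (padded permanent): `σ n = Fin m × Fin m`
with `m = (Nat.unpair n).1`, `f n = per_m` if `complexity per_m ≤ n`, else `0`; this is a VP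
family (`complexity f_n ≤ n`, `m² ≤ n²` variables, degree `≤ n`) with 0/1 coefficients, equal to
`per_m` at every index `Nat.pair m t` with `t ≥ complexity per_m`, where the intrinsic bound
`2^{m^{1-δ}(log(m²+2))^C + C}` loses against Raz–Wigderson's `2^{cm}`. So in X the factor
`(log(n+2))^C` is exactly where CIRCUIT SIZE enters; no bound in the degree and the number of
variables alone can hold (padding normal form, Disproof §3.3). [folklore] -/
theorem shadowFormulaTransfer_false_with_vars_calibration (hRW : RazWigdersonMatching) :
    ¬ ∃ δ : ℝ, 0 < δ ∧ ∃ C : ℕ, ∀ (σ : ℕ → Type) [∀ n, Fintype (σ n)] [∀ n, DecidableEq (σ n)]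
      (f : ∀ n, MvPolynomial (σ n) ℂ), IsVPFamily f →
      (∀ (n : ℕ) (m : σ n →₀ ℕ), (f n).coeff m = 0 ∨ (f n).coeff m = 1) →
      ∃ n₀ : ℕ, ∀ n ≥ n₀, (formulaSizeOver monotoneBasis
        (fun a : σ n → Bool => decide (∃ m ∈ (f n).support, ∀ i ∈ m.support, a i = true)) : ℝ)
        ≤ 2 ^ (((f n).totalDegree : ℝ) ^ (1 - δ) *
          (Real.log ((Fintype.card (σ n) : ℝ) + 2)) ^ C + C) := by
  rintro ⟨δ, hδ, C, hC⟩
  obtain ⟨c, hc, m₀, hm₀⟩ := hRW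
  -- the padded permanent family
  let padPer : ∀ n : ℕ, MvPolynomial (Fin (Nat.unpair n).1 × Fin (Nat.unpair n).1) ℂ :=
    fun n => if complexity (perPoly (Fin (Nat.unpair n).1) ℂ) ≤ n
      then perPoly (Fin (Nat.unpair n).1) ℂ else 0
  have hpad_of : ∀ n, complexity (perPoly (Fin (Nat.unpair n).1) ℂ) ≤ n →
      padPer n = perPoly (Fin (Nat.unpair n).1) ℂ := fun n h => if_pos h
  have hpad_not : ∀ n, ¬ complexity (perPoly (Fin (Nat.unpair n).1) ℂ) ≤ n → padPer n = 0 :=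
    fun n h => if_neg h
  have hVP : IsVPFamily padPer := by
    refine ⟨⟨⟨2, fun n => ?_⟩, ⟨1, fun n => ?_⟩⟩, ⟨1, fun n => ?_⟩⟩
    · simp only [Fintype.card_prod, Fintype.card_fin]
      have := Nat.unpair_left_le n
      nlinarith
    · show (padPer n).totalDegree ≤ n ^ 1 + 1
      by_cases h : complexity (perPoly (Fin (Nat.unpair n).1) ℂ) ≤ n
      · rw [hpad_of n h, totalDegree_perPoly_fin, pow_one]
        have := Nat.unpair_left_le n
        omega
      · rw [hpad_not n h, MvPolynomial.totalDegree_zero, pow_one]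
        omega
    · show complexity (padPer n) ≤ n ^ 1 + 1
      by_cases h : complexity (perPoly (Fin (Nat.unpair n).1) ℂ) ≤ n
      · rw [hpad_of n h, pow_one]; omega
      · rw [hpad_not n h, complexity_zero_eq, pow_one]; omega
  have h01 : ∀ (n : ℕ) (mo : Fin (Nat.unpair n).1 × Fin (Nat.unpair n).1 →₀ ℕ),
      (padPer n).coeff mo = 0 ∨ (padPer n).coeff mo = 1 := by
    intro n mo
    by_cases h : complexity (perPoly (Fin (Nat.unpair n).1) ℂ) ≤ n
    · rw [hpad_of n h]; exact coeff_perPoly_eq_zero_or_one ℂ mo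
    · rw [hpad_not n h]; simp
  obtain ⟨n₀, hn₀⟩ := hC (fun n => Fin (Nat.unpair n).1 × Fin (Nat.unpair n).1) padPer hVP h01
  -- the window, with rate `c / 2^(C+1)` to absorb `log(m² + 2) ≤ 2 log(m + 2)`
  have hc₁pos : 0 < c / 2 ^ (C + 1) := by positivity
  obtain ⟨N, hN⟩ := eventually_atTop.mp ((tendsto_natCast_atTop_atTop (R := ℝ)).eventually
    (eventually_window δ hδ C (c / 2 ^ (C + 1)) hc₁pos))
  obtain ⟨m, hmm₀, hmN, hm1⟩ : ∃ m : ℕ, m₀ ≤ m ∧ N ≤ m ∧ 1 ≤ m :=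
    ⟨max (max m₀ N) 1, (le_max_left _ _).trans (le_max_left _ _),
      (le_max_right _ _).trans (le_max_left _ _), le_max_right _ _⟩
  -- the index: `n = ⟨m, t⟩` with `t ≥ n₀` and `t ≥ complexity per_m`
  obtain ⟨n, hn₀n, hun, hcompl⟩ : ∃ n : ℕ, n₀ ≤ n ∧ (Nat.unpair n).1 = m ∧
      complexity (perPoly (Fin (Nat.unpair n).1) ℂ) ≤ n := by
    refine ⟨Nat.pair m (max n₀ (complexity (perPoly (Fin m) ℂ))),
      (le_max_left _ _).trans (Nat.right_le_pair _ _), by rw [Nat.unpair_pair], ?_⟩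
    rw [Nat.unpair_pair]
    exact (le_max_right _ _).trans (Nat.right_le_pair _ _)
  have hb := hn₀ n hn₀n
  simp only [hpad_of n hcompl, shadow_perPoly_eq ℂ, totalDegree_perPoly_fin ℂ,
    Fintype.card_prod, Fintype.card_fin, Nat.cast_mul] at hb
  rw [hun] at hb
  -- hb : L(PM_m) ≤ 2 ^ (m^(1-δ) * log (m*m + 2)^C + C); RW: 2^(c m) ≤ L(PM_m)
  have hr := hm₀ m hmm₀
  have hw := hN m hmN
  have hMpos : (0 : ℝ) < m := by exact_mod_cast hm1
  have hchain := hr.trans hb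
  rw [Real.rpow_le_rpow_left_iff (by norm_num : (1 : ℝ) < 2)] at hchain
  -- estimate the intrinsic budget
  have hlog0 : 0 ≤ Real.log ((m : ℝ) * m + 2) := Real.log_nonneg (by nlinarith)
  have hlog : Real.log ((m : ℝ) * m + 2) ≤ 2 * Real.log ((m : ℝ) + 2) := by
    calc Real.log ((m : ℝ) * m + 2) ≤ Real.log (((m : ℝ) + 2) ^ 2) :=
          Real.log_le_log (by nlinarith) (by nlinarith)
      _ = 2 * Real.log ((m : ℝ) + 2) := by rw [Real.log_pow]; norm_num
  have hpowC : Real.log ((m : ℝ) * m + 2) ^ C ≤ 2 ^ C * Real.log ((m : ℝ) + 2) ^ C := by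
    calc _ ≤ (2 * Real.log ((m : ℝ) + 2)) ^ C := pow_le_pow_left₀ hlog0 hlog C
      _ = 2 ^ C * Real.log ((m : ℝ) + 2) ^ C := by rw [mul_pow]
  have hrpow0 : 0 ≤ (m : ℝ) ^ (1 - δ) := (Real.rpow_pos_of_pos hMpos _).le
  have hlogM0 : 0 ≤ Real.log ((m : ℝ) + 2) ^ C := pow_nonneg (Real.log_nonneg (by linarith)) C
  have h2C : (1 : ℝ) ≤ 2 ^ C := one_le_pow₀ (by norm_num)
  have h1 : (m : ℝ) ^ (1 - δ) * Real.log ((m : ℝ) * m + 2) ^ C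
      ≤ 2 ^ C * ((m : ℝ) ^ (1 - δ) * Real.log ((m : ℝ) + 2) ^ C) := by
    calc _ ≤ (m : ℝ) ^ (1 - δ) * (2 ^ C * Real.log ((m : ℝ) + 2) ^ C) :=
          mul_le_mul_of_nonneg_left hpowC hrpow0
      _ = _ := by ring
  have hC0 : (0 : ℝ) ≤ C := Nat.cast_nonneg C
  have h2 : (m : ℝ) ^ (1 - δ) * Real.log ((m : ℝ) * m + 2) ^ C + C
      ≤ 2 ^ C * ((m : ℝ) ^ (1 - δ) * Real.log ((m : ℝ) + 2) ^ C + C) := by nlinarith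
  have h3 : (2 : ℝ) ^ C * (c / 2 ^ (C + 1) * m) = c / 2 * m := by
    rw [pow_succ]; field_simp
  have h4 : (2 : ℝ) ^ C * ((m : ℝ) ^ (1 - δ) * Real.log ((m : ℝ) + 2) ^ C + C) < c / 2 * m := by
    rw [← h3]; exact mul_lt_mul_of_pos_left hw (by positivity)
  nlinarith

end Summit.ValiantsHypothesis.ValiantsHypothesis.Cruxes.ShadowFormulaTransfer.Disproof
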